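import Summits.QuantumFields.YangMills.Theorems.BalabanUVNodesN12GaugeLetterLocExplicitLocal
import HarnessLib

/-!
# BalabanUVNodes ∕ N12 — THE LOCAL SHADOW LETTER IS A REGION-BOX LETTER: if the bond set `𝒞` contains the `k`-shadow `⟨B^k y, μ⟩` of every fine point `y` within walk-distance `R + L^k` of `Ω₁(Z)`,
# then every member of `𝐁_k(Z)_i` (`i ≤ k`) with a segment end within walk-distance `R` of `Ω₁(Z)` has its `k`-shadow in `𝒞` — the `hGmem` row of the local (σ)_N capstones read off the knit's box

Cell `pub-ymgap` (HUMAN RULINGS D-0062 ∕ D-0149), WIDTH SEAT `pub-ymgap-dag-n12-w3` g4 (node N12 = [B15]; key K1⁹ `stmt-QuantumFields-27364` (KEY MAP v2), `--kind proof --supports … --as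
helper`; count-neutral).  THEOREMS ONLY (0 `def`, 0 `instance`, 0 `sorry`); word bookkeeping (`embIter_unshift_eq_walkEnd`, `walkEnd_append`) + one composition.

★★ `shadowLetter_of_box` (any `X`, `R`, `𝒞`; levels `i` with `Lⁱ ≤ L^k`); ★★★ `exists_gaugeLetterLoc_atRecord_explicit_local_of_box` — `N12GaugeLetterLocExplicitLocal.exists_gaugeLetterLoc_atRecord_explicit_local`
(the class corner dag-n12-d's `(viii)_local` keys on) with `hGmem` replaced by the box letter
`hBox : ∀ x ∈ Ω₁(Z), ∀ w, |w| ≤ ℓ_k + m′·L^k + L^k → ∀ μ, ⟨blockIter k (walkEnd x w), μ⟩ ∈ 𝒞` — no members, no `𝐁_k(Z)`, a statement about the region box only.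

HONEST FRAMING.  Lattice bookkeeping + composition by name; every displayed letter stays a HYPOTHESIS; nothing of Bałaban's asserted; count-neutral; N12 NOT discharged; K1⁹ NOT closed; counts
unmoved (typed 28∕28 · discharged 5∕27); one finite 𝕋⁴ programme at fixed ε — R4 closes the conditional rung `BalabanLadder.UV` only; the Yang–Mills mass gap (Clay) is NOT proved by any of this;
nothing continuum ∕ ℝ⁴ ∕ OS.
-/

noncomputable section

open scoped Matrix.Norms.L2Operator BigOperators

namespace Summit.QuantumFields.YangMills.BalabanUVNodes.N12ShadowLetterOfBox

open Literature.MathematicalPhysics.QuantumFieldTheory.Balaban1983to89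
open T4Continuum GaugeField B15DeterminingSets BlockAveraging
open T4CubeChartGnomonic (SU2)
open B16Sect1Backgrounds (toMS)
open B14.Eq213MaximalDomains (side)
open B14.Eq213DetSet (Bj maxDomT)
open B14.Eq216Concrete (inputs)
open B14.Eq22Determines (blockIter)
open B8Eq17ClassAkV1 (plaqsOf)
open ExpMeanLog (deltaSU)
open Literature.MathematicalPhysics.QuantumFieldTheory.BalabanImbrieJaffe1984to88.BIJ85Eq453GaugeField (qsstarGIter0)
open Summit.QuantumFields.YangMills.BalabanUVNodes.N12BlockChains (embIter_unshift_eq_walkEnd)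
open Summit.QuantumFields.YangMills.BalabanUVNodes.N12GaugeLetterLocExplicitLocal (exists_gaugeLetterLoc_atRecord_explicit_local)

variable {P : Params}

/-! ## §1 The shadow letter from the box letter -/

/-- ★★ **THE LOCAL SHADOW LETTER FROM A BOX LETTER.**  If `𝒞` contains `⟨B^k(walkEnd x w), μ⟩` for every `x ∈ X`, every fine word `w` of length `≤ R + L^k` and every `μ`, then for every member `c`
of `𝔹_i` (`i ≤ k`, `Lⁱ ≤ L^k`) with `ι_i c₋` or `ι_i c₊` `= walkEnd x w`, `|w| ≤ R`, the shadow `⟨B^k(ι_i c₋), μ(c)⟩` lies in `𝒞` (`ι_i c₋ = walkEnd (ι_i c₊) ((−e_μ)^{Lⁱ})`).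
[cite: Balaban1987RG1, (0.1) p.251 (bookkeeping); Balaban1988Convergent, (2.2) p.255] -/
theorem shadowLetter_of_box {k : ℕ} (X : Set (Site P 0)) (R : ℕ) (𝒞 : Set (PBond P k)) {𝔹 : DetSet P}
    (hpow : ∀ i, i ≤ k → P.L ^ i ≤ P.L ^ k)
    (hBox : ∀ x ∈ X, ∀ w : List (Letter P.d), w.length ≤ R + P.L ^ k → ∀ μ : Fin P.d, (⟨blockIter k (walkEnd x w), μ⟩ : PBond P k) ∈ 𝒞) :
    ∀ x ∈ X, ∀ i ≤ k, ∀ c ∈ bondsOf (𝔹 i),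
      (∃ w : List (Letter P.d), w.length ≤ R ∧ (walkEnd x w = embIter i c.src ∨ walkEnd x w = embIter i c.tgt)) →
      blockIter k (embIter i c.tgt) ≠ blockIter k (embIter i c.src) → (⟨blockIter k (embIter i c.src), c.dir⟩ : PBond P k) ∈ 𝒞 := by
  intro x hx i hi c _ hw _
  obtain ⟨w, hwl, hwe⟩ := hw
  rcases hwe with hsrc | htgt
  · have h := hBox x hx w (by omega) c.dir
    rwa [hsrc] at h
  · -- reach `ι_i c₋` from `ι_i c₊` by `Lⁱ` backward letters
    have hback : embIter i c.src = walkEnd x (w ++ List.replicate (P.L ^ i) (c.dir, false)) := by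
      rw [walkEnd_append, htgt]
      have h := embIter_unshift_eq_walkEnd i (c.tgt : Site P i) c.dir
      have hc : (c.tgt : Site P i).unshift c.dir = c.src := by
        show (c.src.shift c.dir).unshift c.dir = c.src
        exact B10StarCount.unshift_shift _ _
      rw [hc] at h
      exact h
    have hlen : (w ++ List.replicate (P.L ^ i) (c.dir, false)).length ≤ R + P.L ^ k := by
      rw [List.length_append, List.length_replicate]; exact add_le_add hwl (hpow i hi)
    have h := hBox x hx _ hlen c.dir
    rwa [← hback] at h

/-! ## §2 The explicit class capstone with the box letter -/

/-- ★★★ **THE (σ)_N LETTER OF RECORD, EXPLICIT, CLASS EDITION, BOX LETTER** — `N12GaugeLetterLocExplicitLocal.exists_gaugeLetterLoc_atRecord_explicit_local` with the local shadow geometry `hGmem`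
replaced by the REGION-BOX letter `hBox` (the `k`-shadows of all fine points within walk-distance `ℓ_k + m′·L^k + L^k` of `Ω₁(Z)` lie in `𝒞`).  RESIDUE: CLASS `hmin` · DATUM `W 𝒞 ρn` · REGION
GEOMETRY `hGN`, `hN1`, `hBox` · NUMERICS.
[cite: Balaban1985Variational, (2)–(4) p.278, (16)–(18) p.280; Balaban1985RegularSpaces, (1.7) p.77, (1.19) p.79; Balaban1985Averaging, Prop. 2 (52)–(53) p.26; Balaban1988Convergent, (2.2) p.255, (2.12)–(2.13) pp.256–257, (2.16) p.257, p.267] -/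
theorem exists_gaugeLetterLoc_atRecord_explicit_local_of_box {F : T4Family} (ν : Node00.Stage7Numerics) (Kt : ℕ) {k : ℕ} (hk0 : 0 < k) (hk : k ≤ (F.P Kt).m + (F.P Kt).K)
    (hdiv : side (F.P Kt).L ν.M₁ k ∣ (F.P Kt).sitesPerDir 0) (Z : Set (Site (F.P Kt) 0))
    -- NUMERICS (i): a level guard `k + c ≤ m + K` with `4d + m′ + 3 < 2·L^c` (no wrapping), and `M₁ ≥ (4d + m′)·L² + 2d·L + 12` (radii), `m′ = 3·(d·((L−1)∕2)) + 5`
    {c : ℕ} (hkc : k + c ≤ (F.P Kt).m + (F.P Kt).K) (hc : 4 * (F.P Kt).d + (3 * ((F.P Kt).d * (((F.P Kt).L - 1) / 2)) + 5) + 3 < 2 * (F.P Kt).L ^ c)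
    (hMrad : (4 * (F.P Kt).d + (3 * ((F.P Kt).d * (((F.P Kt).L - 1) / 2)) + 5)) * (F.P Kt).L ^ 2 + 2 * (F.P Kt).d * (F.P Kt).L + 12 ≤ ν.M₁)
    -- the region-normalised datum and the minimiser
    {ρn : ℝ} (hρn : 0 ≤ ρn)
    (W : GaugeField (F.P Kt) k SU2) (𝒞 : Set (PBond (F.P Kt) k)) (hD : ∀ c ∈ 𝒞, dist1 (W c) ≤ ρn)
    {U₀ : GaugeField (F.P Kt) 0 SU2}
    (hmin : IsMinimizer (Node00.avOfRecord F 2 Kt) (Node00.regMSCoPOfRecord F 2 ν Kt k (maxDomT ν.M₁ Z)) (Bj ν.M₁ Z k)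
      (avgFamily (Node00.avOfRecord F 2 Kt) (qsstarGIter0 k W)) U₀)
    -- geometry of the neighbourhood (dag-n12-w6's letters, verbatim)
    (N : Set (PBond (F.P Kt) 0))
    (hGN : ∀ b ∈ N, (b.src ∉ maxDomT ν.M₁ Z 1 ∨ b.tgt ∉ maxDomT ν.M₁ Z 1) → blockIter k b.tgt ≠ blockIter k b.src →
      (⟨blockIter k b.src, b.dir⟩ : PBond (F.P Kt) k) ∈ 𝒞)
    (hN1 : ∀ p : Plaq (F.P Kt) 0, ((⟨p.src, p.μ⟩ : PBond (F.P Kt) 0) ∈ {b : PBond (F.P Kt) 0 | b.src ∈ maxDomT ν.M₁ Z 1} ∨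
        (⟨p.src.shift p.μ, p.ν⟩ : PBond (F.P Kt) 0) ∈ {b : PBond (F.P Kt) 0 | b.src ∈ maxDomT ν.M₁ Z 1} ∨
        (⟨p.src.shift p.ν, p.μ⟩ : PBond (F.P Kt) 0) ∈ {b : PBond (F.P Kt) 0 | b.src ∈ maxDomT ν.M₁ Z 1} ∨
        (⟨p.src, p.ν⟩ : PBond (F.P Kt) 0) ∈ {b : PBond (F.P Kt) 0 | b.src ∈ maxDomT ν.M₁ Z 1}) →
      (⟨p.src, p.μ⟩ : PBond (F.P Kt) 0) ∈ N ∧ (⟨p.src.shift p.μ, p.ν⟩ : PBond (F.P Kt) 0) ∈ N ∧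
        (⟨p.src.shift p.ν, p.μ⟩ : PBond (F.P Kt) 0) ∈ N ∧ (⟨p.src, p.ν⟩ : PBond (F.P Kt) 0) ∈ N)
    -- the class threshold `εreg` of NODE 00's class (the minimiser's own class supplies the graded bound): positive and small
    (hεpos : 0 < ν.εreg)
    (hα3 : (143 * (((((F.P Kt).d + 4 : ℕ) : ℝ)) ^ 2 / 4) ^ 2) * (ν.εreg * (F.P Kt).L ^ 2) ≤ 1 / 3)
    (hα2 : 2 * (ν.εreg * (F.P Kt).L ^ 2) ≤ 2 * deltaSU (Fin 2) / ((((F.P Kt).d + 4) * (F.P Kt).L : ℕ) : ℝ) ^ 2)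
    (haN : (((((F.P Kt).d + 2) * (F.P Kt).L : ℕ) : ℝ) ^ 2 / 4) * (2 * (ν.εreg * (F.P Kt).L ^ 2)) < deltaSU (Fin 2))
    -- the family's support numerics: `M₁ ≥ ((d+4)L + 6)·L²`
    (hM₁ : (((F.P Kt).d + 4) * (F.P Kt).L + 6) * (F.P Kt).L ^ 2 ≤ ν.M₁)
    -- GEOMETRY instead of the datum letter: the `k`-shadows of the face-crossing members of `𝐁_k(Z)` lie in `𝒞`
    -- REGION-BOX letter: `𝒞` contains the `k`-shadow `⟨B^k y, μ⟩` of every fine point `y` within walk-distance `ℓ_k + m′·L^k + L^k` of `Ω₁(Z)`, every direction `μ`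
    (hBox : ∀ x ∈ maxDomT ν.M₁ Z 1, ∀ w : List (Letter (F.P Kt).d), w.length ≤ (∑ i ∈ Finset.range (k + 1), ((F.P Kt).d * (((F.P Kt).L ^ i - 1) / 2) + 1)) + (3 * ((F.P Kt).d * (((F.P Kt).L - 1) / 2)) + 5) * (F.P Kt).L ^ k + (F.P Kt).L ^ k →
      ∀ μ : Fin (F.P Kt).d, (⟨blockIter k (walkEnd x w), μ⟩ : PBond (F.P Kt) k) ∈ 𝒞) :
    ∃ σ : GaugeTransf (F.P Kt) 0 SU2,
      (∀ j, j ≤ k → ∀ b ∈ bondsOf (Bj ν.M₁ Z k j), toMS σ j b.src = 1 ∧ toMS σ j b.tgt = 1) ∧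
        (∀ p : Plaq (F.P Kt) 0, ((⟨p.src, p.μ⟩ : PBond (F.P Kt) 0) ∈ {b : PBond (F.P Kt) 0 | b.src ∈ maxDomT ν.M₁ Z 1} ∨
            (⟨p.src.shift p.μ, p.ν⟩ : PBond (F.P Kt) 0) ∈ {b : PBond (F.P Kt) 0 | b.src ∈ maxDomT ν.M₁ Z 1} ∨
            (⟨p.src.shift p.ν, p.μ⟩ : PBond (F.P Kt) 0) ∈ {b : PBond (F.P Kt) 0 | b.src ∈ maxDomT ν.M₁ Z 1} ∨
            (⟨p.src, p.ν⟩ : PBond (F.P Kt) 0) ∈ {b : PBond (F.P Kt) 0 | b.src ∈ maxDomT ν.M₁ Z 1}) →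
          ‖((gaugeAct σ U₀ ⟨p.src, p.μ⟩ : SU2) : Matrix (Fin 2) (Fin 2) ℂ) - 1‖ ≤
              max ρn ((((2 * (∑ i ∈ Finset.range (k + 1), ((F.P Kt).d * (((F.P Kt).L ^ i - 1) / 2) + 1)) + 1 +
                  (3 * ((F.P Kt).d * (((F.P Kt).L - 1) / 2)) + 5) * (F.P Kt).L ^ k : ℕ) : ℝ)) ^ 2 / 4 * (ν.εreg * (F.P Kt).eta 0 ^ 2) +
                ((3 * ((F.P Kt).d * (((F.P Kt).L - 1) / 2)) + 5 : ℕ) : ℝ) * (6 * ((((((F.P Kt).d + 2) * (F.P Kt).L : ℕ) : ℝ) ^ 2 / 4) * (2 * (ν.εreg * (F.P Kt).L ^ 2))) * ∑ i ∈ Finset.range k, ((F.P Kt).L : ℝ) ^ i) + ((3 * ((F.P Kt).d * (((F.P Kt).L - 1) / 2)) + 5 : ℕ) : ℝ) * ρn) ∧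
            ‖((gaugeAct σ U₀ ⟨p.src.shift p.μ, p.ν⟩ : SU2) : Matrix (Fin 2) (Fin 2) ℂ) - 1‖ ≤
              max ρn ((((2 * (∑ i ∈ Finset.range (k + 1), ((F.P Kt).d * (((F.P Kt).L ^ i - 1) / 2) + 1)) + 1 +
                  (3 * ((F.P Kt).d * (((F.P Kt).L - 1) / 2)) + 5) * (F.P Kt).L ^ k : ℕ) : ℝ)) ^ 2 / 4 * (ν.εreg * (F.P Kt).eta 0 ^ 2) +
                ((3 * ((F.P Kt).d * (((F.P Kt).L - 1) / 2)) + 5 : ℕ) : ℝ) * (6 * ((((((F.P Kt).d + 2) * (F.P Kt).L : ℕ) : ℝ) ^ 2 / 4) * (2 * (ν.εreg * (F.P Kt).L ^ 2))) * ∑ i ∈ Finset.range k, ((F.P Kt).L : ℝ) ^ i) + ((3 * ((F.P Kt).d * (((F.P Kt).L - 1) / 2)) + 5 : ℕ) : ℝ) * ρn) ∧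
            ‖((gaugeAct σ U₀ ⟨p.src.shift p.ν, p.μ⟩ : SU2) : Matrix (Fin 2) (Fin 2) ℂ) - 1‖ ≤
              max ρn ((((2 * (∑ i ∈ Finset.range (k + 1), ((F.P Kt).d * (((F.P Kt).L ^ i - 1) / 2) + 1)) + 1 +
                  (3 * ((F.P Kt).d * (((F.P Kt).L - 1) / 2)) + 5) * (F.P Kt).L ^ k : ℕ) : ℝ)) ^ 2 / 4 * (ν.εreg * (F.P Kt).eta 0 ^ 2) +
                ((3 * ((F.P Kt).d * (((F.P Kt).L - 1) / 2)) + 5 : ℕ) : ℝ) * (6 * ((((((F.P Kt).d + 2) * (F.P Kt).L : ℕ) : ℝ) ^ 2 / 4) * (2 * (ν.εreg * (F.P Kt).L ^ 2))) * ∑ i ∈ Finset.range k, ((F.P Kt).L : ℝ) ^ i) + ((3 * ((F.P Kt).d * (((F.P Kt).L - 1) / 2)) + 5 : ℕ) : ℝ) * ρn) ∧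
            ‖((gaugeAct σ U₀ ⟨p.src, p.ν⟩ : SU2) : Matrix (Fin 2) (Fin 2) ℂ) - 1‖ ≤
              max ρn ((((2 * (∑ i ∈ Finset.range (k + 1), ((F.P Kt).d * (((F.P Kt).L ^ i - 1) / 2) + 1)) + 1 +
                  (3 * ((F.P Kt).d * (((F.P Kt).L - 1) / 2)) + 5) * (F.P Kt).L ^ k : ℕ) : ℝ)) ^ 2 / 4 * (ν.εreg * (F.P Kt).eta 0 ^ 2) +
                ((3 * ((F.P Kt).d * (((F.P Kt).L - 1) / 2)) + 5 : ℕ) : ℝ) * (6 * ((((((F.P Kt).d + 2) * (F.P Kt).L : ℕ) : ℝ) ^ 2 / 4) * (2 * (ν.εreg * (F.P Kt).L ^ 2))) * ∑ i ∈ Finset.range k, ((F.P Kt).L : ℝ) ^ i) + ((3 * ((F.P Kt).d * (((F.P Kt).L - 1) / 2)) + 5 : ℕ) : ℝ) * ρn)) ∧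
        (∀ b ∈ inputs (Bj ν.M₁ Z k), b ∈ N →
          ‖((gaugeAct σ U₀ b : SU2) : Matrix (Fin 2) (Fin 2) ℂ) - 1‖ ≤
              max ρn ((((2 * (∑ i ∈ Finset.range (k + 1), ((F.P Kt).d * (((F.P Kt).L ^ i - 1) / 2) + 1)) + 1 +
                  (3 * ((F.P Kt).d * (((F.P Kt).L - 1) / 2)) + 5) * (F.P Kt).L ^ k : ℕ) : ℝ)) ^ 2 / 4 * (ν.εreg * (F.P Kt).eta 0 ^ 2) +
                ((3 * ((F.P Kt).d * (((F.P Kt).L - 1) / 2)) + 5 : ℕ) : ℝ) * (6 * ((((((F.P Kt).d + 2) * (F.P Kt).L : ℕ) : ℝ) ^ 2 / 4) * (2 * (ν.εreg * (F.P Kt).L ^ 2))) * ∑ i ∈ Finset.range k, ((F.P Kt).L : ℝ) ^ i) + ((3 * ((F.P Kt).d * (((F.P Kt).L - 1) / 2)) + 5 : ℕ) : ℝ) * ρn)) := by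
  refine exists_gaugeLetterLoc_atRecord_explicit_local ν Kt hk0 hk hdiv Z hkc hc hMrad hρn W 𝒞 hD hmin N hGN hN1 hεpos hα3 hα2 haN hM₁ ?_
  exact shadowLetter_of_box (maxDomT ν.M₁ Z 1) _ 𝒞 (fun i hi => Nat.pow_le_pow_right (F.P Kt).L_pos hi) hBox

end Summit.QuantumFields.YangMills.BalabanUVNodes.N12ShadowLetterOfBox

end
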